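import Mathlib.Analysis.SpecialFunctions.Pow.Asymptotics
import Mathlib.Analysis.SpecialFunctions.Pow.Real
import Mathlib.Analysis.Complex.Exponential
import Mathlib.Algebra.Polynomial.Roots
import Mathlib.Combinatorics.Colex
import Mathlib.LinearAlgebra.Dimension.Finite
import Mathlib.RingTheory.MvPolynomial.Basic
import Mathlib.Data.Fintype.Powerset
import Literature.Computability.AlgebraicComplexity.NarayananElusive
import HarnessLib

/-!
# Narayanan 2026, Theorem 1 — PROOF (discharge of `Narayanan2026_thm1`)

Topic `Literature/Computability/AlgebraicComplexity`. Companion (proofs only, no new named facts)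
to `NarayananElusive.lean`, which records A. K. Narayanan, *Arithmetic circuit lower bounds from
sumset expansion* (arXiv:2607.15848v1, 17 Jul 2026), **Theorem 1** (p. 2) as the named fact
`Narayanan2026_thm1`:

> For large enough `m`, `z ↦ (z, z², z⁴, …, z^{2^{m−1}})` is `(⌊m^{9/10}⌋, 2)`-elusive.

Here we prove it: `theorem Narayanan2026_thm1_holds : Narayanan2026_thm1`. (The tree's second
rendering of the same printed theorem, `Narayanan2026_thm_1` of `NarayananElusiveCurve.lean` —
curve inlined, "`(s, 2)`-elusive for every `s` with `s^{10} ≤ m^9`" — then follows from the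
already-proved bridge `Narayanan2026_thm1.isElusive_of_pow_le` of `NarayananElusiveRemark.lean`;
that one-line discharge is left to a sibling file so that this file depends on
`NarayananElusive.lean` only.)

## The printed proof (§2, pp. 8–9) and how it is followed

Write `f` for the doubling curve and let `Γ = (g₁, …, g_m) : ℂˢ → ℂᵐ` be a map all of whose
coordinates have total degree `≤ r` (`r = 2` in the paper).

1. *Annihilator by a dimension count.* Let `M` be the span of a family of multilinear monomials
   `x^a = ∏_{i ∈ S} xᵢ` (`S ⊆ [m]`). Substituting `xᵢ ↦ gᵢ` is a linear map `ι_Γ` from `M` into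
   polynomials of bounded degree in `s` variables; if `dim M` exceeds the dimension of the
   target, `ker ι_Γ ≠ 0`: there is `h_Γ = ∑_S h_S x^S ≠ 0` with `h_Γ ∘ Γ = 0` identically, so
   `h_Γ` vanishes on `Γ(ℂˢ)` (paper: `M` = monomials of Hamming weight exactly `ℓ = ⌊s/2⌋`,
   `dim M = C(m, ℓ) > (m/ℓ)^ℓ ≫ 4ˢ > C(s+2ℓ, 2ℓ)`). Here: `exists_linearRelation_of_restrictDegree`
   applied in `isElusive_doublingCurve_of_pow_lt`.
2. *Binary uniqueness.* `h_Γ(f(z)) = ∑_S h_S z^{∑_{i∈S} 2^i}` and the exponents `∑_{i ∈ S} 2^i`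
   are pairwise distinct (uniqueness of binary expansion), so `h_Γ ∘ f` is a NONZERO univariate
   polynomial. Here: `doublingExp_injective` (from Mathlib's `Finset.geomSum_injective`).
3. *A point of the curve outside `Γ(ℂˢ)`.* The paper exhibits an explicit one, `f(ζᵇ)` for a
   primitive `p`-th root of unity `ζ` (`p > 2^m` prime) and some `b` in any set `B` of residues
   of size `dim M`, via Chebotarev's theorem on minors of the prime-order Fourier matrix.

Deviations (each only moves the threshold `m₀`, which the statement leaves unspecified):

* In step 1 we take ALL `2^m` multilinear monomials and bound the target crudely: a product of
  `|S| ≤ m` coordinates of degree `≤ r` has total degree `≤ r m`, hence lies in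
  `MvPolynomial.restrictDegree (Fin s) ℂ (r m)`, of dimension `≤ (r m + 1)ˢ`
  (`finrank_restrictDegree_fin_le`). So the count used is `(r m + 1)ˢ < 2^m`
  (`isElusive_doublingCurve_of_pow_lt`, valid for every `r`), and for `s = ⌊m^{9/10}⌋`, `r = 2`
  it holds for all large `m` (`exists_pow_floor_rpow_lt_two_pow`: `m^{9/10} · log(2m+1) ≤
  2 m^{9/10} log m < m log 2` eventually, from `log x = o(x^{1/10})`).
* In step 3 the explicit hitting set is not needed for Theorem 1 AS STATED (`f(ℂ) ⊄ Γ(ℂˢ)`):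
  a nonzero polynomial over the infinite field `ℂ` has a non-root (`Polynomial.funext`), which
  is a point `f(z) ∉ Γ(ℂˢ)`. Chebotarev's theorem is therefore not formalized here.

## References

* [Narayanan2026] A. K. Narayanan, *Arithmetic circuit lower bounds from sumset expansion*,
  arXiv:2607.15848v1 (2026), Theorem 1 (§1.2, p. 2), proof §2 (pp. 8–9). Held text
  `paper:arxiv-2607.15848` (READ: pp. 2–4, 8–9).
* [Raz2010] R. Raz, *Elusive functions and lower bounds for arithmetic circuits*, Theory of
  Computing 6 (2010), Def. 1.1 (`IsElusive`).
-/

noncomputable section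

namespace Literature.Computability.AlgebraicComplexity

open MvPolynomial

/-! ### Step 2 of the printed proof: uniqueness of binary expansion -/

/-- The exponent of the multilinear monomial `x^S = ∏_{i∈S} xᵢ` along the doubling curve,
`S ↦ ∑_{i ∈ S} 2^i`, is injective on subsets `S ⊆ {0, …, m−1}` (uniqueness of binary
expansion; Narayanan 2026, §2: "the exponents of `ζᵇ` in the above sum are all distinct").
[cite: Narayanan2026, §2 (proof of Thm. 1)] -/
theorem doublingExp_injective (m : ℕ) :
    Function.Injective (fun S : Finset (Fin m) => ∑ i ∈ S, 2 ^ (i : ℕ)) := by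
  intro S T h
  have h' : ∑ i ∈ S.map Fin.valEmbedding, 2 ^ i = ∑ i ∈ T.map Fin.valEmbedding, 2 ^ i := by
    simpa only [Finset.sum_map, Fin.valEmbedding_apply] using h
  exact Finset.map_injective Fin.valEmbedding (Finset.geomSum_injective le_rfl h')

/-! ### Step 1 of the printed proof: the dimension count -/

/-- Polynomials in `s` variables of degree `≤ d` in each variable form a space of dimension
`≤ (d + 1)ˢ` (in fact `=`; the monomial basis is indexed by exponent vectors bounded by `d`).
[folklore] -/
theorem finrank_restrictDegree_fin_le (k : Type*) [Field k] (s d : ℕ) :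
    Module.finrank k (restrictDegree (Fin s) k d) ≤ (d + 1) ^ s := by
  have hb := Module.finrank_eq_nat_card_basis
    (basisRestrictSupport k {n : Fin s →₀ ℕ | ∀ i, n i ≤ d})
  have hle : Nat.card ↥{n : Fin s →₀ ℕ | ∀ i, n i ≤ d} ≤ Nat.card (Fin s → Fin (d + 1)) :=
    Nat.card_le_card_of_injective
      (fun n i => (⟨n.1 i, Nat.lt_succ_of_le (n.2 i)⟩ : Fin (d + 1)))
      (by
        intro a b h
        apply Subtype.ext
        ext i
        have := congrFun h i
        simpa using this)
  calc Module.finrank k (restrictDegree (Fin s) k d)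
      = Nat.card ↥{n : Fin s →₀ ℕ | ∀ i, n i ≤ d} := hb
    _ ≤ Nat.card (Fin s → Fin (d + 1)) := hle
    _ = (d + 1) ^ s := by
        simp only [Nat.card_eq_fintype_card, Fintype.card_fun, Fintype.card_fin]

/-- **The dimension count** (Narayanan 2026, §2: `dim M > dim ℂ[z₁,…,z_s]_{≤2ℓ}` forces
`ker ι_Γ ≠ 0`): more than `(d + 1)ˢ` polynomials in `s` variables, each of degree `≤ d` in every
variable, satisfy a nontrivial linear relation. [cite: Narayanan2026, §2 (proof of Thm. 1)] -/
theorem exists_linearRelation_of_restrictDegree {k : Type*} [Field k] {ι : Type*} [Fintype ι]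
    {s d : ℕ} (v : ι → MvPolynomial (Fin s) k) (hv : ∀ i, v i ∈ restrictDegree (Fin s) k d)
    (hcard : (d + 1) ^ s < Fintype.card ι) :
    ∃ c : ι → k, ∑ i, c i • v i = 0 ∧ ∃ i, c i ≠ 0 := by
  have hnot : ¬ LinearIndependent k (fun i => (⟨v i, hv i⟩ : restrictDegree (Fin s) k d)) := by
    intro hli
    have h1 := hli.fintype_card_le_finrank
    have h2 := finrank_restrictDegree_fin_le k s d
    exact lt_irrefl _ (hcard.trans_le (h1.trans h2))
  obtain ⟨c, hc, i, hi⟩ := Fintype.not_linearIndependent_iff.mp hnot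
  refine ⟨c, ?_, i, hi⟩
  have := congrArg (restrictDegree (Fin s) k d).subtype hc
  rw [map_sum, map_zero] at this
  simpa only [map_smul, Submodule.subtype_apply] using this

/-! ### Theorem 1, combinatorial core: `(r m + 1)ˢ < 2^m ⇒ (s, r)`-elusive -/

/-- **Core of Narayanan's Theorem 1** (the printed argument with the threshold made explicit):
if `(r m + 1)ˢ < 2^m` then the doubling curve `z ↦ (z, z², z⁴, …, z^{2^{m−1}})` is
`(s, r)`-elusive. Proof: for a degree-`≤ r` map `Γ : ℂˢ → ℂᵐ`, the `2^m` products
`∏_{i∈S} Γᵢ` lie in the `≤ (rm+1)ˢ`-dimensional space of polynomials of degree `≤ r m` in each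
variable, so `∑_S c_S ∏_{i∈S} Γᵢ = 0` for some `c ≠ 0`; if `f(ℂ) ⊆ Γ(ℂˢ)` then evaluating along
the curve gives `∑_S c_S z^{∑_{i∈S} 2^i} = 0` for all `z ∈ ℂ`, a nonzero polynomial (distinct
exponents) with infinitely many roots — contradiction. [cite: Narayanan2026, Thm. 1 and §2] -/
theorem isElusive_doublingCurve_of_pow_lt {m s r : ℕ} (h : (r * m + 1) ^ s < 2 ^ m) :
    IsElusive (doublingCurve m) s r := by
  classical
  intro Γ hΓ hsub
  -- Step 1: the products `∏_{i ∈ S} Γ i` have degree `≤ r m` in each variable …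
  have hv : ∀ S : Finset (Fin m), (∏ i ∈ S, Γ i) ∈ restrictDegree (Fin s) ℂ (r * m) := by
    intro S
    refine restrictTotalDegree_le_restrictDegree (Fin s) ℂ (r * m) ?_
    rw [mem_restrictTotalDegree]
    calc (∏ i ∈ S, Γ i).totalDegree ≤ ∑ i ∈ S, (Γ i).totalDegree := totalDegree_finsetProd _ _
      _ ≤ ∑ _i ∈ S, r := Finset.sum_le_sum fun i _ => hΓ i
      _ = S.card * r := by rw [Finset.sum_const, smul_eq_mul]
      _ ≤ m * r := Nat.mul_le_mul_right r (S.card_le_univ.trans_eq (Fintype.card_fin m))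
      _ = r * m := Nat.mul_comm m r
  -- … and there are `2^m > (r m + 1)^s` of them, so they are linearly dependent.
  have hcard : (r * m + 1) ^ s < Fintype.card (Finset (Fin m)) := by
    rwa [Fintype.card_finset, Fintype.card_fin]
  obtain ⟨c, hc, S₀, hS₀⟩ :=
    exists_linearRelation_of_restrictDegree (fun S : Finset (Fin m) => ∏ i ∈ S, Γ i) hv hcard
  -- Step 2/3: evaluate the relation along the curve (using `f(ℂ) ⊆ Γ(ℂˢ)`).
  have hz : ∀ z : ℂ, ∑ S : Finset (Fin m), c S * z ^ (∑ i ∈ S, 2 ^ (i : ℕ)) = 0 := by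
    intro z
    obtain ⟨y, hy⟩ := hsub (Set.mem_range_self (f := polyMapEval (doublingCurve m)) fun _ => z)
    have hyi : ∀ i : Fin m, eval y (Γ i) = z ^ 2 ^ (i : ℕ) := by
      intro i
      have := congrFun hy i
      simpa [doublingCurve] using this
    have h0 := congrArg (eval y) hc
    rw [map_sum, map_zero] at h0
    simpa only [smul_eval, map_prod, hyi, Finset.prod_pow_eq_pow_sum] using h0
  -- The univariate polynomial `∑_S c_S X^{∑_{i∈S} 2^i}` vanishes on `ℂ`, hence is zero …
  have hP0 : (∑ S : Finset (Fin m), Polynomial.C (c S) * Polynomial.X ^ (∑ i ∈ S, 2 ^ (i : ℕ)) :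
      Polynomial ℂ) = 0 := by
    apply Polynomial.funext
    intro z
    simp only [Polynomial.eval_finsetSum, Polynomial.eval_mul, Polynomial.eval_C,
      Polynomial.eval_pow, Polynomial.eval_X, Polynomial.eval_zero]
    exact hz z
  -- … but its coefficient at `X^{∑_{i∈S₀} 2^i}` is `c S₀ ≠ 0` (binary uniqueness).
  have hcoeff := congrArg (fun Q : Polynomial ℂ => Q.coeff (∑ i ∈ S₀, 2 ^ (i : ℕ))) hP0
  simp only [Polynomial.finsetSum_coeff, Polynomial.coeff_C_mul_X_pow, Polynomial.coeff_zero]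
    at hcoeff
  rw [Finset.sum_eq_single S₀
    (fun S _ hS => if_neg fun h' => hS ((doublingExp_injective m) h').symm)
    (fun h' => absurd (Finset.mem_univ S₀) h'), if_pos rfl] at hcoeff
  exact hS₀ hcoeff

/-! ### The threshold for `s = ⌊m^{9/10}⌋`, `r = 2` -/

open Real Filter Asymptotics in
/-- **The count for the printed parameters**: `(2m + 1)^{⌊m^{9/10}⌋} < 2^m` for all large `m`
(`⌊m^{9/10}⌋ · log(2m+1) ≤ m^{9/10} · 2 log m < m · log 2`, since `log m = o(m^{1/10})`).
The paper's sharper count `C(m,ℓ) > (m/ℓ)^ℓ ≫ 4ˢ` plays the same role. [folklore] -/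
theorem exists_pow_floor_rpow_lt_two_pow :
    ∃ m₀ : ℕ, ∀ m ≥ m₀, (2 * m + 1) ^ ⌊((m : ℝ) ^ ((9 : ℝ) / 10))⌋₊ < 2 ^ m := by
  have hlog2 : 0 < Real.log 2 := Real.log_pos one_lt_two
  have hlo := (isLittleO_log_rpow_atTop (show (0 : ℝ) < 1 / 10 by norm_num)).def
    (show (0 : ℝ) < Real.log 2 / 4 from div_pos hlog2 (by norm_num))
  obtain ⟨a, ha⟩ := Filter.eventually_atTop.mp hlo
  refine ⟨max 3 ⌈a⌉₊, fun m hm => ?_⟩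
  have hm3 : 3 ≤ m := le_of_max_le_left hm
  have hma : a ≤ (m : ℝ) :=
    (Nat.le_ceil a).trans (by exact_mod_cast le_of_max_le_right hm)
  have hm0 : (0 : ℝ) < m := by exact_mod_cast (show 0 < m by omega)
  have hm1 : (1 : ℝ) ≤ m := by exact_mod_cast (show 1 ≤ m by omega)
  have hm3' : (3 : ℝ) ≤ m := by exact_mod_cast hm3
  set s : ℕ := ⌊((m : ℝ) ^ ((9 : ℝ) / 10))⌋₊ with hs
  -- `log m ≤ (log 2 / 4) m^{1/10}`
  have h1 : Real.log m ≤ Real.log 2 / 4 * (m : ℝ) ^ ((1 : ℝ) / 10) := by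
    have := ha m hma
    rwa [Real.norm_of_nonneg (Real.log_nonneg hm1),
      Real.norm_of_nonneg (Real.rpow_nonneg hm0.le _)] at this
  -- `log (2m+1) ≤ 2 log m` (as `2m + 1 ≤ m²` for `m ≥ 3`)
  have h2 : Real.log (2 * m + 1) ≤ 2 * Real.log m := by
    have h' : Real.log (2 * m + 1) ≤ Real.log ((m : ℝ) ^ 2) :=
      Real.log_le_log (by positivity) (by nlinarith)
    have h'' : Real.log ((m : ℝ) ^ 2) = 2 * Real.log m := by
      rw [Real.log_pow]; norm_num
    linarith
  have hs_le : (s : ℝ) ≤ (m : ℝ) ^ ((9 : ℝ) / 10) := Nat.floor_le (Real.rpow_nonneg hm0.le _)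
  have hsplit : (m : ℝ) ^ ((9 : ℝ) / 10) * (m : ℝ) ^ ((1 : ℝ) / 10) = m := by
    rw [← Real.rpow_add hm0]; norm_num
  -- the key inequality `s · log(2m+1) < m · log 2`
  have key : (s : ℝ) * Real.log (2 * m + 1) < m * Real.log 2 := by
    calc (s : ℝ) * Real.log (2 * m + 1) ≤ (m : ℝ) ^ ((9 : ℝ) / 10) * (2 * Real.log m) :=
          mul_le_mul hs_le h2 (Real.log_nonneg (by linarith)) (Real.rpow_nonneg hm0.le _)
      _ ≤ (m : ℝ) ^ ((9 : ℝ) / 10) * (2 * (Real.log 2 / 4 * (m : ℝ) ^ ((1 : ℝ) / 10))) :=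
          mul_le_mul_of_nonneg_left (by linarith [h1]) (Real.rpow_nonneg hm0.le _)
      _ = Real.log 2 / 2 * ((m : ℝ) ^ ((9 : ℝ) / 10) * (m : ℝ) ^ ((1 : ℝ) / 10)) := by ring
      _ = Real.log 2 / 2 * m := by rw [hsplit]
      _ < m * Real.log 2 := by nlinarith [mul_pos hm0 hlog2]
  -- exponentiate
  have e1 : Real.exp ((s : ℝ) * Real.log (2 * m + 1)) = (2 * (m : ℝ) + 1) ^ s := by
    rw [Real.exp_nat_mul, Real.exp_log (by positivity)]
  have e2 : Real.exp ((m : ℝ) * Real.log 2) = (2 : ℝ) ^ m := by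
    rw [Real.exp_nat_mul, Real.exp_log (by norm_num)]
  have hexp : (2 * (m : ℝ) + 1) ^ s < (2 : ℝ) ^ m := by
    rw [← e1, ← e2]
    exact Real.exp_lt_exp.mpr key
  exact_mod_cast hexp

/-! ### Theorem 1 -/

/-- **Narayanan 2026, Theorem 1** (arXiv:2607.15848, p. 2), PROVED — discharge of the named fact
`Narayanan2026_thm1`: for all large `m`, the doubling curve `z ↦ (z, z², z⁴, …, z^{2^{m−1}})` is
`(⌊m^{9/10}⌋, 2)`-elusive (Raz 2010, Def. 1.1 = `IsElusive`, over `ℂ`). From the core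
`isElusive_doublingCurve_of_pow_lt` at `r = 2` and the threshold
`exists_pow_floor_rpow_lt_two_pow`. [cite: Narayanan2026, Thm. 1] -/
theorem Narayanan2026_thm1_holds : Narayanan2026_thm1 := by
  obtain ⟨m₀, hm₀⟩ := exists_pow_floor_rpow_lt_two_pow
  exact ⟨m₀, fun m hm => isElusive_doublingCurve_of_pow_lt (hm₀ m hm)⟩

end Literature.Computability.AlgebraicComplexity

end
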